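import Mathlib
import Literature.Probability.Percolation.TwoClusterConditionalAssociation
import Literature.Probability.Percolation.PercolationProofs
import Literature.Probability.LatticeModels.ProdBernoulliIndependence
import HarnessLib

/-!
# Crux `PercNearOneGluing.AdditiveGluing` (stmt-CriticalPhenomena-4576), line
`replica-splice-at-entrance` — stub `stub_knLemma2`

Helper file for the crux skeleton (lead prover-line-stmt-CriticalPhenomena-4576-c3).  Proves exactly
the registered stub signature `stub_knLemma2`; lands with `--supports stmt-CriticalPhenomena-4576`.

Kozma–Nitzan, arXiv:2401.12397, **Lemma 2** (p. 6) for the relay set `A = {a₁, a₂, a₃}` and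
`X = {1, 2} = {1} ∪ {2}`, in denominator-free form on the finite weighted graph `Fin n`
(`μ = prodBernoulli w` on `BondConfig (Fin n) = Set (Sym2 (Fin n))`).  With
`N₁₂ = {A₁₂ ↮ a₃} = {a₁ ↮ a₃} ∩ {a₂ ↮ a₃}`, `N₁ = {a₁ ↮ A₂₃}`, `N₂ = {a₂ ↮ A₁₃}` and
`φ(12) = P(o ↔ A₁₂ | N₁₂)`, `φ(k) = P(o ↔ aₖ | Nₖ)`, the lemma `φ(1) + φ(2) ≤ φ(12)` reads
`P(o↔a₁, N₁) P(N₁₂) P(N₂) + P(o↔a₂, N₂) P(N₁₂) P(N₁) ≤ P(o↔A₁₂, N₁₂) P(N₁) P(N₂)`.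

The HYPOTHESIS of the stub is the statement of the neighbouring stub `stub_bhkSets`
(van den Berg–Häggström–Kahn 2006, Thms. 1.3 / 1.4 for the open edge cluster
`C_S = ⋃ s ∈ S, C_s` of a vertex SET `S`): part 1 = one-cluster positive association given
`{S ↮ X}`, part 2 = two-cluster negative correlation given `{S ↮ S'}`.

Proof (KN pp. 5–6).  Put `M = {a₁ ↮ a₂} ∩ {a₁ ↮ a₃} ∩ {a₂ ↮ a₃}`.  An event `Q` increasing in
and determined by `C_S` (e.g. `{a ↔ b}` with `a ∈ S`: an open path from `a` lies in
`C_a ⊆ C_S`, `knLemma2_openConn_detBy`) is fed to the hypothesis through the increasing function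
`F_Q = 1{C | ∃ ω ∈ Q, C_S(ω) ⊆ C}` of a set of pairs `C`, which satisfies `F_Q(C_S(ω)) = 1_Q(ω)`.
* Lemma 1(i), `k = 1, 2`: part 2 of the hypothesis with `S = {aₖ}`, `S' = A ∖ aₖ = {aᵢ, aⱼ}`,
  `f = 1{o ↔ aₖ}` (a function of `C_S`) and `g = 1{aᵢ ↔ aⱼ}` (a function of `C_{S'}`), then
  complementation in `g`: `P(o↔aₖ, Nₖ) P(M) ≤ P(o↔aₖ, M) P(Nₖ)`.
* Lemma 1(ii): part 1 with `S = {a₁, a₂}`, `X = {a₃}`, `f = 1{o ↔ A₁₂}`, `g = 1{a₁ ↔ a₂}` (both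
  functions of `C_S`), then complementation in `g`: `P(o↔A₁₂, M) P(N₁₂) ≤ P(o↔A₁₂, N₁₂) P(M)`.
* On `M` the events `{o ↔ a₁}`, `{o ↔ a₂}` are disjoint: `P(o↔a₁, M) + P(o↔a₂, M) = P(o↔A₁₂, M)`.
* Harris (`N₁`, `N₂` decreasing, `N₁ ∩ N₂ = M`): `P(N₁) P(N₂) ≤ P(M)`, which settles the
  degenerate case `P(M) = 0`; otherwise multiply the goal by `P(M)` and chain the three bounds
  (`knLemma2_arith`).
-/

namespace Summit.CriticalPhenomena.PercolationContinuityZ3.Theorems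

open MeasureTheory Set Literature.Probability.LatticeModels Literature.Probability.Percolation

noncomputable section

section Indicators

variable {V : Type*}

/-- An open path starting at `s` runs inside every set of pairs containing the open edge cluster
`C_s`: if `s ↔ t` in `ω` and `C_s(ω) ⊆ C`, then `s` and `t` are linked by a chain of pairs of `C`.
[cite: VandenbergHaggstromKahn2005, §1 p. 3 (definition of C_s)] -/
theorem reachable_fromEdgeSet_of_openEdgeCluster_subset (ω : BondConfig V) {s t : V}
    {C : Set (Sym2 V)} (hC : openEdgeCluster ω s ⊆ C) (h : (openGraph ω).Reachable s t) :
    (SimpleGraph.fromEdgeSet C).Reachable s t := by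
  rw [SimpleGraph.reachable_iff_reflTransGen] at h ⊢
  induction h with
  | refl => exact Relation.ReflTransGen.refl
  | tail hab hbc ih =>
    rename_i b c
    refine ih.tail ?_
    have hbc' := (openGraph_adj ω b c).1 hbc
    rw [SimpleGraph.fromEdgeSet_adj]
    refine ⟨hC ((mem_openEdgeCluster_iff ω s _).2 ⟨hbc'.1, ?_, fun v hv => ?_⟩), hbc'.2⟩
    · rw [Sym2.mk_isDiag_iff]
      exact hbc'.2
    · have hsb : (openGraph ω).Reachable s b := (SimpleGraph.reachable_iff_reflTransGen s b).2 hab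
      rcases Sym2.mem_iff.1 hv with rfl | rfl
      · exact hsb
      · exact hsb.trans hbc.reachable

/-- A chain of OPEN pairs is an open path. [folklore] -/
theorem reachable_openGraph_of_fromEdgeSet (ω : BondConfig V) {C : Set (Sym2 V)} (hC : C ⊆ ω)
    {s t : V} (h : (SimpleGraph.fromEdgeSet C).Reachable s t) : (openGraph ω).Reachable s t :=
  h.mono (SimpleGraph.fromEdgeSet_mono hC)

/-- **`{a ↔ b}` (`a ∈ S`) is increasing in, and determined by, the cluster `C_S = ⋃ s ∈ S, C_s` of
the set `S`**: if `a ↔ b` in `ω` and `C_S(ω) ⊆ C_S(ω')` then `a ↔ b` in `ω'` (an open path from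
`a` lies in `C_a(ω) ⊆ C_S(ω) ⊆ C_S(ω') ⊆ ω'`).
[cite: KozmaNitzan2024, §2.2 and proof of Lemma 1 (p. 5, "increasing and determined by the cluster of A")] -/
theorem knLemma2_openConn_detBy (S : Finset V) {a : V} (ha : a ∈ S) (b : V) (ω ω' : BondConfig V)
    (h : ω ∈ openConn a b)
    (hsub : (⋃ s ∈ S, openEdgeCluster ω s) ⊆ ⋃ s ∈ S, openEdgeCluster ω' s) : ω' ∈ openConn a b :=
  reachable_openGraph_of_fromEdgeSet ω' (Set.iUnion₂_subset fun s _ => openEdgeCluster_subset ω' s)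
    (reachable_fromEdgeSet_of_openEdgeCluster_subset ω
      ((Finset.subset_set_biUnion_of_mem (f := fun s => openEdgeCluster ω s) ha).trans hsub) h)

/-- Symmetric form of `knLemma2_openConn_detBy`: `{b ↔ a}` (`a ∈ S`) is increasing in, and
determined by, `C_S`. [cite: KozmaNitzan2024, §2.2] -/
theorem knLemma2_openConn_detBy' (S : Finset V) {a : V} (ha : a ∈ S) (b : V) (ω ω' : BondConfig V)
    (h : ω ∈ openConn b a)
    (hsub : (⋃ s ∈ S, openEdgeCluster ω s) ⊆ ⋃ s ∈ S, openEdgeCluster ω' s) : ω' ∈ openConn b a :=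
  SimpleGraph.Reachable.symm (knLemma2_openConn_detBy S ha b ω ω' (SimpleGraph.Reachable.symm h) hsub)

/-- The indicator of the up-closure `{C | ∃ ω ∈ Q, C_S(ω) ⊆ C}` of an event `Q` is an increasing
function of the set of pairs `C`. [folklore] -/
theorem knLemma2_monotone_upInd (Q : Set (BondConfig V)) (S : Finset V) :
    Monotone ({C : Set (Sym2 V) | ∃ ω ∈ Q, (⋃ s ∈ S, openEdgeCluster ω s) ⊆ C}.indicator
      (1 : Set (Sym2 V) → ℝ)) := by
  intro C C' hCC'
  by_cases h : C ∈ {C : Set (Sym2 V) | ∃ ω ∈ Q, (⋃ s ∈ S, openEdgeCluster ω s) ⊆ C}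
  · have h' : C' ∈ {C : Set (Sym2 V) | ∃ ω ∈ Q, (⋃ s ∈ S, openEdgeCluster ω s) ⊆ C} := by
      obtain ⟨ω, hω, hsub⟩ := h
      exact ⟨ω, hω, hsub.trans hCC'⟩
    rw [indicator_of_mem h, indicator_of_mem h', Pi.one_apply, Pi.one_apply]
  · rw [indicator_of_notMem h]
    exact indicator_nonneg (fun _ _ => zero_le_one) _

/-- For `Q` increasing in and determined by `C_S`, the indicator of the up-closure of `Q`
evaluated at `C_S(ω)` is `1_Q(ω)`.
[cite: VandenbergHaggstromKahn2005, §1 p. 3 ("A is increasing and determined by the open cluster of s")] -/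
theorem knLemma2_upInd_apply {Q : Set (BondConfig V)} {S : Finset V}
    (hQ : ∀ ω ω' : BondConfig V, ω ∈ Q →
      (⋃ s ∈ S, openEdgeCluster ω s) ⊆ (⋃ s ∈ S, openEdgeCluster ω' s) → ω' ∈ Q)
    (ω : BondConfig V) :
    {C : Set (Sym2 V) | ∃ ω' ∈ Q, (⋃ s ∈ S, openEdgeCluster ω' s) ⊆ C}.indicator
        (1 : Set (Sym2 V) → ℝ) (⋃ s ∈ S, openEdgeCluster ω s) = Q.indicator 1 ω := by
  by_cases hω : ω ∈ Q
  · have h1 : (⋃ s ∈ S, openEdgeCluster ω s) ∈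
        {C : Set (Sym2 V) | ∃ ω' ∈ Q, (⋃ s ∈ S, openEdgeCluster ω' s) ⊆ C} := ⟨ω, hω, subset_rfl⟩
    rw [indicator_of_mem h1, indicator_of_mem hω, Pi.one_apply, Pi.one_apply]
  · have h1 : (⋃ s ∈ S, openEdgeCluster ω s) ∉
        {C : Set (Sym2 V) | ∃ ω' ∈ Q, (⋃ s ∈ S, openEdgeCluster ω' s) ⊆ C} := by
      rintro ⟨ω', hω', hsub⟩
      exact hω (hQ ω' ω hω' hsub)
    rw [indicator_of_notMem h1, indicator_of_notMem hω]

end Indicators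

section Integrals

variable {Ω : Type*} [MeasurableSpace Ω]

/-- `∫_D 1_E dμ = μ(D ∩ E)`. [folklore] -/
theorem setIntegral_of_eq_indicator (μ : Measure Ω) [IsFiniteMeasure μ] {f : Ω → ℝ}
    {D E : Set Ω} (hE : MeasurableSet E) (hf : ∀ ω, f ω = E.indicator 1 ω) :
    ∫ ω in D, f ω ∂μ = μ.real (D ∩ E) := by
  rw [show f = E.indicator 1 from funext hf, setIntegral_indicator hE]
  simp only [Pi.one_apply, setIntegral_const, smul_eq_mul, mul_one]

/-- `∫_D 1_{E₁} 1_{E₂} dμ = μ(D ∩ (E₁ ∩ E₂))`. [folklore] -/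
theorem setIntegral_mul_of_eq_indicator (μ : Measure Ω) [IsFiniteMeasure μ] {f g : Ω → ℝ}
    {D E₁ E₂ : Set Ω} (hE₁ : MeasurableSet E₁) (hE₂ : MeasurableSet E₂)
    (hf : ∀ ω, f ω = E₁.indicator 1 ω) (hg : ∀ ω, g ω = E₂.indicator 1 ω) :
    ∫ ω in D, f ω * g ω ∂μ = μ.real (D ∩ (E₁ ∩ E₂)) := by
  refine setIntegral_of_eq_indicator μ (hE₁.inter hE₂) fun ω => ?_
  show f ω * g ω = (E₁ ∩ E₂).indicator 1 ω
  rw [hf, hg]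
  exact (congrFun (Set.inter_indicator_one (s := E₁) (t := E₂) (M₀ := ℝ)) ω).symm

/-- Real arithmetic of the complementation step after a two-cluster (negative correlation) bound:
`m y ≤ x q`, `m = q + q'`, `x = y + y'` give `x q' ≤ y' m`. [folklore] -/
theorem knLemma2_arith_twoCluster {m q q' x y y' : ℝ} (hq : q + q' = m) (hx : y + y' = x)
    (key : m * y ≤ x * q) : x * q' ≤ y' * m := by
  subst hq hx
  linear_combination key

/-- Real arithmetic of the complementation step after a one-cluster (positive association) bound:
`x q ≤ m y`, `m = q + q'`, `x = y + y'` give `y' m ≤ x q'`. [folklore] -/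
theorem knLemma2_arith_oneCluster {m q q' x y y' : ℝ} (hq : q + q' = m) (hx : y + y' = x)
    (key : x * q ≤ m * y) : y' * m ≤ x * q' := by
  subst hq hx
  linear_combination key

/-- **Events form of a two-cluster bound, complemented in the second event**: from
`μ(D) ∫_D 1_{E₁} 1_{E₂} ≤ (∫_D 1_{E₁})(∫_D 1_{E₂})` one gets
`μ(E₁ ∩ D) μ(D ∩ E₂ᶜ) ≤ μ(E₁ ∩ D ∩ E₂ᶜ) μ(D)`.
[cite: KozmaNitzan2024, proof of Lemma 1(i) (p. 5)] -/
theorem knLemma2_twoCluster_events (μ : Measure Ω) [IsFiniteMeasure μ] {f g : Ω → ℝ}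
    {D E₁ E₂ : Set Ω} (hE₁ : MeasurableSet E₁) (hE₂ : MeasurableSet E₂)
    (hf : ∀ ω, f ω = E₁.indicator 1 ω) (hg : ∀ ω, g ω = E₂.indicator 1 ω)
    (key : μ.real D * ∫ ω in D, f ω * g ω ∂μ ≤ (∫ ω in D, f ω ∂μ) * ∫ ω in D, g ω ∂μ) :
    μ.real (E₁ ∩ D) * μ.real (D ∩ E₂ᶜ) ≤ μ.real (E₁ ∩ (D ∩ E₂ᶜ)) * μ.real D := by
  rw [setIntegral_mul_of_eq_indicator μ hE₁ hE₂ hf hg, setIntegral_of_eq_indicator μ hE₁ hf,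
    setIntegral_of_eq_indicator μ hE₂ hg, ← Set.inter_assoc] at key
  have hq : μ.real (D ∩ E₂) + μ.real (D ∩ E₂ᶜ) = μ.real D := by
    rw [← Set.sdiff_eq]
    exact measureReal_inter_add_sdiff hE₂
  have hx : μ.real (D ∩ E₁ ∩ E₂) + μ.real (D ∩ E₁ ∩ E₂ᶜ) = μ.real (D ∩ E₁) := by
    rw [← Set.sdiff_eq]
    exact measureReal_inter_add_sdiff hE₂
  rw [Set.inter_comm E₁ D, Set.inter_left_comm E₁ D, ← Set.inter_assoc]
  exact knLemma2_arith_twoCluster hq hx key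

/-- **Events form of a one-cluster bound, complemented in the second event**: from
`(∫_D 1_{E₁})(∫_D 1_{E₂}) ≤ μ(D) ∫_D 1_{E₁} 1_{E₂}` one gets
`μ(E₁ ∩ D ∩ E₂ᶜ) μ(D) ≤ μ(E₁ ∩ D) μ(D ∩ E₂ᶜ)`.
[cite: KozmaNitzan2024, proof of Lemma 1(ii) (p. 5)] -/
theorem knLemma2_oneCluster_events (μ : Measure Ω) [IsFiniteMeasure μ] {f g : Ω → ℝ}
    {D E₁ E₂ : Set Ω} (hE₁ : MeasurableSet E₁) (hE₂ : MeasurableSet E₂)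
    (hf : ∀ ω, f ω = E₁.indicator 1 ω) (hg : ∀ ω, g ω = E₂.indicator 1 ω)
    (key : (∫ ω in D, f ω ∂μ) * (∫ ω in D, g ω ∂μ) ≤ μ.real D * ∫ ω in D, f ω * g ω ∂μ) :
    μ.real (E₁ ∩ (D ∩ E₂ᶜ)) * μ.real D ≤ μ.real (E₁ ∩ D) * μ.real (D ∩ E₂ᶜ) := by
  rw [setIntegral_mul_of_eq_indicator μ hE₁ hE₂ hf hg, setIntegral_of_eq_indicator μ hE₁ hf,
    setIntegral_of_eq_indicator μ hE₂ hg, ← Set.inter_assoc] at key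
  have hq : μ.real (D ∩ E₂) + μ.real (D ∩ E₂ᶜ) = μ.real D := by
    rw [← Set.sdiff_eq]
    exact measureReal_inter_add_sdiff hE₂
  have hx : μ.real (D ∩ E₁ ∩ E₂) + μ.real (D ∩ E₁ ∩ E₂ᶜ) = μ.real (D ∩ E₁) := by
    rw [← Set.sdiff_eq]
    exact measureReal_inter_add_sdiff hE₂
  rw [Set.inter_comm E₁ D, Set.inter_left_comm E₁ D, ← Set.inter_assoc]
  exact knLemma2_arith_oneCluster hq hx key

/-- Real-arithmetic core of KN Lemma 2: the two Lemma-1(i) bounds `xₖ m ≤ yₖ pₖ`, the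
Lemma-1(ii) bound `y₁₂ p₁₂ ≤ x₁₂ m`, disjointness `y₁ + y₂ = y₁₂` and Harris `p₁ p₂ ≤ m` give
`x₁ p₁₂ p₂ + x₂ p₁₂ p₁ ≤ x₁₂ p₁ p₂` (all quantities nonnegative, `xₖ ≤ pₖ`). [folklore] -/
theorem knLemma2_arith {x₁ x₂ x₁₂ y₁ y₂ y₁₂ p₁ p₂ p₁₂ m : ℝ}
    (hx₁ : 0 ≤ x₁) (hx₂ : 0 ≤ x₂) (hp₁ : 0 ≤ p₁) (hp₂ : 0 ≤ p₂) (hp₁₂ : 0 ≤ p₁₂) (hm : 0 ≤ m)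
    (hx₁p : x₁ ≤ p₁) (hx₂p : x₂ ≤ p₂)
    (h1 : x₁ * m ≤ y₁ * p₁) (h2 : x₂ * m ≤ y₂ * p₂) (h12 : y₁₂ * p₁₂ ≤ x₁₂ * m)
    (hy : y₁ + y₂ = y₁₂) (hH : p₁ * p₂ ≤ m) :
    x₁ * p₁₂ * p₂ + x₂ * p₁₂ * p₁ ≤ x₁₂ * p₁ * p₂ := by
  rcases eq_or_lt_of_le hm with hm0 | hmpos
  · -- `m = 0`: then `p₁ p₂ = 0` and both sides vanish
    rw [← hm0] at hH
    have hp : p₁ * p₂ = 0 := le_antisymm hH (mul_nonneg hp₁ hp₂)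
    rcases mul_eq_zero.1 hp with h | h
    · rw [le_antisymm (h ▸ hx₁p) hx₁, h]; ring_nf; rfl
    · rw [le_antisymm (h ▸ hx₂p) hx₂, h]; ring_nf; rfl
  · refine le_of_mul_le_mul_right ?_ hmpos
    calc (x₁ * p₁₂ * p₂ + x₂ * p₁₂ * p₁) * m
        = x₁ * m * (p₁₂ * p₂) + x₂ * m * (p₁₂ * p₁) := by ring
      _ ≤ y₁ * p₁ * (p₁₂ * p₂) + y₂ * p₂ * (p₁₂ * p₁) :=
        add_le_add (mul_le_mul_of_nonneg_right h1 (mul_nonneg hp₁₂ hp₂))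
          (mul_le_mul_of_nonneg_right h2 (mul_nonneg hp₁₂ hp₁))
      _ = y₁₂ * p₁₂ * (p₁ * p₂) := by rw [← hy]; ring
      _ ≤ x₁₂ * m * (p₁ * p₂) := mul_le_mul_of_nonneg_right h12 (mul_nonneg hp₁ hp₂)
      _ = x₁₂ * p₁ * p₂ * m := by ring

end Integrals

/-- **Kozma–Nitzan arXiv:2401.12397 Lemma 2 (p. 6) for `X = {1, 2} = {1} ∪ {2}`,
denominator-free** — superadditivity `φ(1) + φ(2) ≤ φ(1,2)`:
`P(o↔a₁, N₁) P(N₁₂) P(N₂) + P(o↔a₂, N₂) P(N₁₂) P(N₁) ≤ P(o↔A₁₂, N₁₂) P(N₁) P(N₂)` with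
`N₁₂ = {A₁₂ ↮ a₃}`, `N₁ = {a₁ ↮ A₂₃}`, `N₂ = {a₂ ↮ A₁₃}`.  The hypothesis is BHK 2006
Thms. 1.3 / 1.4 for the open edge cluster of a vertex SET (the neighbouring stub `stub_bhkSets`,
taken verbatim); the proof is KN's (Lemma 1 (i)/(ii), disjointness on
`M = {a₁, a₂, a₃ pairwise separated}`, Harris for the degenerate case `P(M) = 0`).
[cite: KozmaNitzan2024, Lemma 2 (p. 6) and Lemma 1 (p. 5)] -/
theorem stub_knLemma2 :
    ((∀ (n : ℕ) (w : Sym2 (Fin n) → unitInterval) (S : Finset (Fin n)) (X : Set (Fin n))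
        (F G : Set (Sym2 (Fin n)) → ℝ), Monotone F → Monotone G → (∀ s ∈ S, s ∉ X) →
        (∫ ω in {ω : BondConfig (Fin n) | ∀ s ∈ S, ∀ x ∈ X, ¬ (openGraph ω).Reachable s x},
            F (⋃ s ∈ S, openEdgeCluster ω s) ∂(prodBernoulli w)) *
          (∫ ω in {ω : BondConfig (Fin n) | ∀ s ∈ S, ∀ x ∈ X, ¬ (openGraph ω).Reachable s x},
            G (⋃ s ∈ S, openEdgeCluster ω s) ∂(prodBernoulli w)) ≤
        (prodBernoulli w).real {ω : BondConfig (Fin n) | ∀ s ∈ S, ∀ x ∈ X, ¬ (openGraph ω).Reachable s x} *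
          ∫ ω in {ω : BondConfig (Fin n) | ∀ s ∈ S, ∀ x ∈ X, ¬ (openGraph ω).Reachable s x},
            F (⋃ s ∈ S, openEdgeCluster ω s) * G (⋃ s ∈ S, openEdgeCluster ω s) ∂(prodBernoulli w)) ∧
    (∀ (n : ℕ) (w : Sym2 (Fin n) → unitInterval) (S S' : Finset (Fin n))
        (F G : Set (Sym2 (Fin n)) → ℝ), Monotone F → Monotone G → Disjoint S S' →
        (prodBernoulli w).real {ω : BondConfig (Fin n) | ∀ s ∈ S, ∀ x ∈ S', ¬ (openGraph ω).Reachable s x} *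
          (∫ ω in {ω : BondConfig (Fin n) | ∀ s ∈ S, ∀ x ∈ S', ¬ (openGraph ω).Reachable s x},
            F (⋃ s ∈ S, openEdgeCluster ω s) * G (⋃ s ∈ S', openEdgeCluster ω s) ∂(prodBernoulli w)) ≤
        (∫ ω in {ω : BondConfig (Fin n) | ∀ s ∈ S, ∀ x ∈ S', ¬ (openGraph ω).Reachable s x},
            F (⋃ s ∈ S, openEdgeCluster ω s) ∂(prodBernoulli w)) *
          (∫ ω in {ω : BondConfig (Fin n) | ∀ s ∈ S, ∀ x ∈ S', ¬ (openGraph ω).Reachable s x},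
            G (⋃ s ∈ S', openEdgeCluster ω s) ∂(prodBernoulli w)))) →
      ∀ (n : ℕ) (w : Sym2 (Fin n) → unitInterval) (o a₁ a₂ a₃ : Fin n), a₁ ≠ a₂ → a₁ ≠ a₃ → a₂ ≠ a₃ →
        (prodBernoulli w).real (openConn o a₁ ∩ ((openConn a₁ a₂)ᶜ ∩ (openConn a₁ a₃)ᶜ)) * (prodBernoulli w).real ((openConn a₁ a₃)ᶜ ∩ (openConn a₂ a₃)ᶜ) * (prodBernoulli w).real ((openConn a₂ a₁)ᶜ ∩ (openConn a₂ a₃)ᶜ) +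
          (prodBernoulli w).real (openConn o a₂ ∩ ((openConn a₂ a₁)ᶜ ∩ (openConn a₂ a₃)ᶜ)) * (prodBernoulli w).real ((openConn a₁ a₃)ᶜ ∩ (openConn a₂ a₃)ᶜ) * (prodBernoulli w).real ((openConn a₁ a₂)ᶜ ∩ (openConn a₁ a₃)ᶜ) ≤
        (prodBernoulli w).real ((openConn o a₁ ∪ openConn o a₂) ∩ ((openConn a₁ a₃)ᶜ ∩ (openConn a₂ a₃)ᶜ)) * (prodBernoulli w).real ((openConn a₁ a₂)ᶜ ∩ (openConn a₁ a₃)ᶜ) * (prodBernoulli w).real ((openConn a₂ a₁)ᶜ ∩ (openConn a₂ a₃)ᶜ) := by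
  intro hB n w o a₁ a₂ a₃ h12 h13 h23
  have hmeas : ∀ E : Set (BondConfig (Fin n)), MeasurableSet E := fun _ => MeasurableSet.of_discrete
  -- the conditioning events produced by the hypothesis
  have hD : ∀ a b c : Fin n, {ω : BondConfig (Fin n) | ∀ s ∈ ({a} : Finset (Fin n)),
      ∀ x ∈ ({b, c} : Finset (Fin n)), ¬ (openGraph ω).Reachable s x} = (openConn a b)ᶜ ∩ (openConn a c)ᶜ := by
    intro a b c
    ext ω
    simp only [Finset.mem_singleton, Finset.mem_insert, forall_eq_or_imp, forall_eq, mem_setOf_eq,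
      mem_inter_iff, mem_compl_iff, openConn]
  have hD12 : {ω : BondConfig (Fin n) | ∀ s ∈ ({a₁, a₂} : Finset (Fin n)), ∀ x ∈ ({a₃} : Set (Fin n)),
      ¬ (openGraph ω).Reachable s x} = (openConn a₁ a₃)ᶜ ∩ (openConn a₂ a₃)ᶜ := by
    ext ω
    simp only [Finset.mem_singleton, Finset.mem_insert, Set.mem_singleton_iff, forall_eq_or_imp,
      forall_eq, mem_setOf_eq, mem_inter_iff, mem_compl_iff, openConn]
  -- the events read off the clusters are increasing in, and determined by, `C_S`
  have hU : ∀ ω ω' : BondConfig (Fin n), ω ∈ openConn o a₁ ∪ openConn o a₂ →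
      (⋃ s ∈ ({a₁, a₂} : Finset (Fin n)), openEdgeCluster ω s) ⊆
        (⋃ s ∈ ({a₁, a₂} : Finset (Fin n)), openEdgeCluster ω' s) → ω' ∈ openConn o a₁ ∪ openConn o a₂ :=
    fun ω ω' h hsub => h.imp
      (fun h₁ => knLemma2_openConn_detBy' {a₁, a₂} (Finset.mem_insert_self a₁ {a₂}) o ω ω' h₁ hsub)
      (fun h₂ => knLemma2_openConn_detBy' {a₁, a₂}
        (Finset.mem_insert_of_mem (Finset.mem_singleton_self a₂)) o ω ω' h₂ hsub)
  -- Lemma 1(i), `k = 1`: two-cluster bound with `S = {a₁}`, `S' = {a₂, a₃}`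
  have k1 := hB.2 n w {a₁} {a₂, a₃} _ _ (knLemma2_monotone_upInd (openConn o a₁) {a₁})
    (knLemma2_monotone_upInd (openConn a₂ a₃) {a₂, a₃})
    (by simp only [Finset.disjoint_singleton_left, Finset.mem_insert, Finset.mem_singleton, not_or]
        exact ⟨h12, h13⟩)
  rw [hD] at k1
  have i1 := knLemma2_twoCluster_events (prodBernoulli w) (hmeas _) (hmeas _)
    (knLemma2_upInd_apply (knLemma2_openConn_detBy' {a₁} (Finset.mem_singleton_self a₁) o))
    (knLemma2_upInd_apply (knLemma2_openConn_detBy {a₂, a₃} (Finset.mem_insert_self a₂ {a₃}) a₃)) k1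
  -- Lemma 1(i), `k = 2`: two-cluster bound with `S = {a₂}`, `S' = {a₁, a₃}`
  have k2 := hB.2 n w {a₂} {a₁, a₃} _ _ (knLemma2_monotone_upInd (openConn o a₂) {a₂})
    (knLemma2_monotone_upInd (openConn a₁ a₃) {a₁, a₃})
    (by simp only [Finset.disjoint_singleton_left, Finset.mem_insert, Finset.mem_singleton, not_or]
        exact ⟨fun h => h12 h.symm, h23⟩)
  rw [hD] at k2
  have i2 := knLemma2_twoCluster_events (prodBernoulli w) (hmeas _) (hmeas _)
    (knLemma2_upInd_apply (knLemma2_openConn_detBy' {a₂} (Finset.mem_singleton_self a₂) o))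
    (knLemma2_upInd_apply (knLemma2_openConn_detBy {a₁, a₃} (Finset.mem_insert_self a₁ {a₃}) a₃)) k2
  -- Lemma 1(ii): one-cluster bound with `S = {a₁, a₂}`, `X = {a₃}`
  have k12 := hB.1 n w {a₁, a₂} ({a₃} : Set (Fin n)) _ _
    (knLemma2_monotone_upInd (openConn o a₁ ∪ openConn o a₂) {a₁, a₂})
    (knLemma2_monotone_upInd (openConn a₁ a₂) {a₁, a₂})
    (by
      intro s hs
      simp only [Finset.mem_insert, Finset.mem_singleton] at hs
      rcases hs with rfl | rfl
      · exact fun h => h13 (Set.mem_singleton_iff.1 h)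
      · exact fun h => h23 (Set.mem_singleton_iff.1 h))
  rw [hD12] at k12
  have i12 := knLemma2_oneCluster_events (prodBernoulli w) (hmeas _) (hmeas _)
    (knLemma2_upInd_apply hU)
    (knLemma2_upInd_apply (knLemma2_openConn_detBy {a₁, a₂} (Finset.mem_insert_self a₁ {a₂}) a₂)) k12
  -- the three forms of `M = {a₁ ↮ a₂} ∩ {a₁ ↮ a₃} ∩ {a₂ ↮ a₃}`
  have hM2 : ((openConn a₂ a₁)ᶜ ∩ (openConn a₂ a₃)ᶜ ∩ (openConn a₁ a₃)ᶜ : Set (BondConfig (Fin n))) =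
      (openConn a₁ a₂)ᶜ ∩ (openConn a₁ a₃)ᶜ ∩ (openConn a₂ a₃)ᶜ := by
    ext ω
    simp only [mem_inter_iff, mem_compl_iff, openConn, mem_setOf_eq]
    rw [SimpleGraph.reachable_comm]
    tauto
  have hM12 : ((openConn a₁ a₃)ᶜ ∩ (openConn a₂ a₃)ᶜ ∩ (openConn a₁ a₂)ᶜ : Set (BondConfig (Fin n))) =
      (openConn a₁ a₂)ᶜ ∩ (openConn a₁ a₃)ᶜ ∩ (openConn a₂ a₃)ᶜ :=
    Set.ext fun ω => by simp only [mem_inter_iff]; tauto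
  have hM3 : ((openConn a₁ a₂)ᶜ ∩ (openConn a₁ a₃)ᶜ ∩ ((openConn a₂ a₁)ᶜ ∩ (openConn a₂ a₃)ᶜ) :
      Set (BondConfig (Fin n))) = (openConn a₁ a₂)ᶜ ∩ (openConn a₁ a₃)ᶜ ∩ (openConn a₂ a₃)ᶜ := by
    ext ω
    simp only [mem_inter_iff, mem_compl_iff, openConn, mem_setOf_eq]
    rw [SimpleGraph.reachable_comm (u := a₂) (v := a₁)]
    tauto
  rw [hM2] at i2; rw [hM12] at i12
  -- disjointness of `{o ↔ a₁}` and `{o ↔ a₂}` on `M`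
  have hdisj : (prodBernoulli w).real ((openConn o a₁ ∪ openConn o a₂) ∩
      ((openConn a₁ a₂)ᶜ ∩ (openConn a₁ a₃)ᶜ ∩ (openConn a₂ a₃)ᶜ)) =
      (prodBernoulli w).real (openConn o a₁ ∩ ((openConn a₁ a₂)ᶜ ∩ (openConn a₁ a₃)ᶜ ∩ (openConn a₂ a₃)ᶜ)) +
        (prodBernoulli w).real (openConn o a₂ ∩ ((openConn a₁ a₂)ᶜ ∩ (openConn a₁ a₃)ᶜ ∩ (openConn a₂ a₃)ᶜ)) := by
    rw [Set.union_inter_distrib_right]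
    refine measureReal_union (Set.disjoint_left.2 fun ω hω₁ hω₂ => ?_) (hmeas _)
    exact hω₁.2.1.1 ((show (openGraph ω).Reachable o a₁ from hω₁.1).symm.trans hω₂.1)
  -- Harris: `N₁`, `N₂` are decreasing
  have hH := prodBernoulli_harris_lower w
    (((isUpperSet_openConn a₁ a₂).compl).inter (isUpperSet_openConn a₁ a₃).compl)
    (((isUpperSet_openConn a₂ a₁).compl).inter (isUpperSet_openConn a₂ a₃).compl) (hmeas _) (hmeas _)
  rw [hM3] at hH
  -- assemble
  exact knLemma2_arith measureReal_nonneg measureReal_nonneg measureReal_nonneg measureReal_nonneg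
    measureReal_nonneg measureReal_nonneg (measureReal_mono Set.inter_subset_right)
    (measureReal_mono Set.inter_subset_right) i1 i2 i12 hdisj.symm hH

end

end Summit.CriticalPhenomena.PercolationContinuityZ3.Theorems
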